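import Summits.AnomalousDissipation.AnomalousDissipation.Theorems.MomentParityQuarticGateCoords
import Summits.AnomalousDissipation.AnomalousDissipation.Theorems.MomentParityQuarticGateRows
import Summits.AnomalousDissipation.AnomalousDissipation.Theorems.MomentParityQuarticGateDefectPoly

/-!
# Axial defect certificate for `MomentParity.QuarticGate` (stmt-AnomalousDissipation-11464),
# line `axis-sectors`, stub S3′ — helper II: the row and Euler functionals, the shear group
# ("AxialCertFunctionals")

Support file for the stub `stub_axialDefectCertificate`. In the coordinates of an orthonormal band
basis `b` of `V_N` (vocabulary `IsLevel`, `IsBandTest`, `polyGrad` of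
`Theorems/QuarticGate/Negative/LevelCeiling.lean`):

* `nsGeneratorPairing_polyGrad_eq_sum` — `⟨F(u), ∇p(u)⟩ = Σᵢ ∂ᵢP((u,b)) ⟨F(u), bᵢ⟩`;
* `integrable_eval_mul_nsGeneratorPairing`, `integrable_and_exists_cubicRowFunctional` — cubic rows
  are integrable under a finite law with `∫ ‖u‖⁴ < ∞`, and the row `P ↦ ∫ ⟨F(u), ∇p(u)⟩ dμ` is a
  linear functional on the homogeneous cubics `MvPolynomial.homogeneousSubmodule (Fin n) ℝ 3`;
* `exists_pointRowFunctional` — the pointwise rows `P ↦ ⟨F'(v), ∇p(v)⟩` (in particular the Euler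
  derivatives `P ↦ {p, B_N}(v)`, `ν' = 0`, `f' = 0`) as linear functionals on the homogeneous cubics;
* `finite_shearGroup` — the shear group `H_L = {a : T³ | a 1 = 0, L • a = 0}` is finite.

The first three adapt `Theorems/MomentParityQuarticGateDefectCertificate.lean` (line
`recession-cone`) to the sub-namespace `AxialCert` (slightly generalised), so that this line does not
depend on that file's build.
-/

-- `Summit.<Summit>.<Problem>` is the tree's mandated summit-side namespace (CONVENTIONS §2); for this
-- single-conjunct summit the two coincide, so the duplicate is deliberate.
set_option linter.dupNamespace false

namespace Summit.AnomalousDissipation.AnomalousDissipation.Theorems.MomentParityQuarticGate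

open MeasureTheory Filter MvPolynomial
open scoped InnerProductSpace RealInnerProductSpace ENNReal
open Literature.Analysis.FunctionSpaces Literature.Analysis.FluidPDE
open Summit.AnomalousDissipation.AnomalousDissipation.Theses.MomentParity
open Summit.AnomalousDissipation.AnomalousDissipation.Theorems.QuarticGate.Negative

namespace AxialCert

variable {N n : ℕ} {b : Fin n → UnitAddTorus (Fin 3) → EuclideanSpace ℝ (Fin 3)}

/-! ## The row and the Euler derivative as linear functionals on homogeneous cubics -/

-- adapted from Theorems/MomentParityQuarticGateDefectCertificate.lean (line `recession-cone`)
/-- **The tested generator against a differential field, in coordinates**: for smooth fields `bᵢ`,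
`⟨F(u), ∇p(u)⟩ = Σᵢ ∂ᵢP((u,b)) ⟨F(u), bᵢ⟩`. [folklore] -/
theorem nsGeneratorPairing_polyGrad_eq_sum (hb : ∀ i, Torus.IsSmooth (b i)) (ν : ℝ)
    {f : UnitAddTorus (Fin 3) → EuclideanSpace ℝ (Fin 3)} (hf : Integrable f volume)
    (P : MvPolynomial (Fin n) ℝ) (u : Torus.energySpace (Fin 3)) :
    Torus.nsGeneratorPairing ν f u (polyGrad b P u) =
      ∑ i, eval (fun j => Torus.pairing u.1 (b j)) (pderiv i P) *
        Torus.nsGeneratorPairing ν f u (b i) :=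
  Torus.nsGeneratorPairing_sum_smul ν hf u Finset.univ _ fun i _ => hb i

-- adapted from Theorems/MomentParityQuarticGateDefectCertificate.lean (line `recession-cone`)
/-- **Growth control.** For a homogeneous quadratic `Q` in the coordinates of an orthonormal band
family and a smooth field `w`, `u ↦ Q((u,b)) ⟨F(u), w⟩` is integrable under every finite law on `H`
with `∫ ‖u‖⁴ < ∞` (`|Q((u,b))| ≤ C ‖u‖²`, `|⟨F(u), w⟩| ≤ K (1 + ‖u‖²)`). [folklore] -/
theorem integrable_eval_mul_nsGeneratorPairing (hb : ∀ i, IsBandTest N (b i))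
    (hbo : ∀ i j, ∫ x, ⟪b i x, b j x⟫_ℝ = if i = j then (1 : ℝ) else 0) (ν : ℝ)
    (f : UnitAddTorus (Fin 3) → EuclideanSpace ℝ (Fin 3)) {μ : Measure (Torus.energySpace (Fin 3))}
    [IsFiniteMeasure μ] (h4 : Integrable (fun u : Torus.energySpace (Fin 3) => ‖u‖ ^ 4) μ)
    {Q : MvPolynomial (Fin n) ℝ} (hQ : Q.IsHomogeneous 2)
    {w : UnitAddTorus (Fin 3) → EuclideanSpace ℝ (Fin 3)} (hw : Torus.IsSmooth w) :
    Integrable (fun u : Torus.energySpace (Fin 3) =>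
      eval (fun j => Torus.pairing u.1 (b j)) Q * Torus.nsGeneratorPairing ν f u w) μ := by
  obtain ⟨K, hK0, hK⟩ := Torus.exists_abs_nsGeneratorPairing_le ν f hw
  set C : ℝ := ∑ α ∈ Q.support, |coeff α Q| with hC
  have hC0 : 0 ≤ C := Finset.sum_nonneg fun α _ => abs_nonneg _
  have hcont : Continuous fun u : Torus.energySpace (Fin 3) =>
      eval (fun j => Torus.pairing u.1 (b j)) Q * Torus.nsGeneratorPairing ν f u w :=
    ((continuous_eval Q).comp (continuous_coords hb)).mul
      (Torus.continuous_nsGeneratorPairing ν f hw)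
  have hbound : ∀ u : Torus.energySpace (Fin 3),
      ‖eval (fun j => Torus.pairing u.1 (b j)) Q * Torus.nsGeneratorPairing ν f u w‖ ≤
        C * K * (1 + 2 * ‖u‖ ^ 4) := by
    intro u
    rw [Real.norm_eq_abs, abs_mul]
    have h1 : |eval (fun j => Torus.pairing u.1 (b j)) Q| ≤ C * ‖u‖ ^ 2 :=
      abs_eval_le_of_isHomogeneous hQ fun j => abs_coord_le_norm hb hbo u j
    have h3 : ‖u‖ ^ 2 * (1 + ‖u‖ ^ 2) ≤ 1 + 2 * ‖u‖ ^ 4 := by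
      nlinarith [sq_nonneg (‖u‖ ^ 2 - 1), sq_nonneg ‖u‖]
    calc |eval (fun j => Torus.pairing u.1 (b j)) Q| * |Torus.nsGeneratorPairing ν f u w|
        ≤ (C * ‖u‖ ^ 2) * (K * (1 + ‖u‖ ^ 2)) :=
          mul_le_mul h1 (hK u) (abs_nonneg _) (mul_nonneg hC0 (sq_nonneg _))
      _ = C * K * (‖u‖ ^ 2 * (1 + ‖u‖ ^ 2)) := by ring
      _ ≤ C * K * (1 + 2 * ‖u‖ ^ 4) := mul_le_mul_of_nonneg_left h3 (mul_nonneg hC0 hK0)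
  exact (((integrable_const (1 : ℝ)).add (h4.const_mul 2)).const_mul (C * K)).mono'
    hcont.aestronglyMeasurable (ae_of_all _ hbound)

-- adapted from Theorems/MomentParityQuarticGateDefectCertificate.lean (line `recession-cone`)
/-- **The cubic row functional.** Under a finite law on `H` with `∫ ‖u‖⁴ < ∞`, the row
`u ↦ ⟨F(u), ∇p(u)⟩` of every homogeneous cubic `P` in the coordinates is integrable, and
`P ↦ ∫ ⟨F(u), ∇p(u)⟩ dμ` is a linear functional on the homogeneous cubics. [folklore] -/
theorem integrable_and_exists_cubicRowFunctional (hb : ∀ i, IsBandTest N (b i))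
    (hbo : ∀ i j, ∫ x, ⟪b i x, b j x⟫_ℝ = if i = j then (1 : ℝ) else 0) (ν : ℝ)
    {f : UnitAddTorus (Fin 3) → EuclideanSpace ℝ (Fin 3)} (hf : Integrable f volume)
    (μ : Measure (Torus.energySpace (Fin 3))) [IsFiniteMeasure μ]
    (h4 : Integrable (fun u : Torus.energySpace (Fin 3) => ‖u‖ ^ 4) μ) :
    (∀ P : MvPolynomial (Fin n) ℝ, P.IsHomogeneous 3 →
      Integrable (fun u : Torus.energySpace (Fin 3) =>
        Torus.nsGeneratorPairing ν f u (polyGrad b P u)) μ) ∧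
    ∃ ψ : ↥(homogeneousSubmodule (Fin n) ℝ 3) →ₗ[ℝ] ℝ,
      ∀ P : ↥(homogeneousSubmodule (Fin n) ℝ 3),
        ψ P = ∫ u, Torus.nsGeneratorPairing ν f u (polyGrad b P.1 u) ∂μ := by
  have hint : ∀ P : MvPolynomial (Fin n) ℝ, P.IsHomogeneous 3 →
      Integrable (fun u : Torus.energySpace (Fin 3) =>
        Torus.nsGeneratorPairing ν f u (polyGrad b P u)) μ := fun P hP => by
    simp_rw [nsGeneratorPairing_polyGrad_eq_sum (fun i => (hb i).1) ν hf]
    exact integrable_finsetSum _ fun i _ =>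
      integrable_eval_mul_nsGeneratorPairing hb hbo ν f h4 hP.pderiv (hb i).1
  refine ⟨hint, { toFun := fun P => ∫ u, Torus.nsGeneratorPairing ν f u (polyGrad b P.1 u) ∂μ
                  map_add' := fun P Q => ?_
                  map_smul' := fun c P => ?_ }, fun P => rfl⟩
  · have h : ∀ u : Torus.energySpace (Fin 3), Torus.nsGeneratorPairing ν f u (polyGrad b (P + Q).1 u) =
        Torus.nsGeneratorPairing ν f u (polyGrad b P.1 u) +
          Torus.nsGeneratorPairing ν f u (polyGrad b Q.1 u) := fun u => by
      simp only [Submodule.coe_add, nsGeneratorPairing_polyGrad_eq_sum (fun i => (hb i).1) ν hf,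
        map_add, add_mul, Finset.sum_add_distrib]
    simp_rw [h]
    exact integral_add (hint _ P.2) (hint _ Q.2)
  · have h : ∀ u : Torus.energySpace (Fin 3), Torus.nsGeneratorPairing ν f u (polyGrad b (c • P).1 u) =
        c * Torus.nsGeneratorPairing ν f u (polyGrad b P.1 u) := fun u => by
      simp only [Submodule.coe_smul, nsGeneratorPairing_polyGrad_eq_sum (fun i => (hb i).1) ν hf,
        Derivation.map_smul, smul_eval, Finset.mul_sum, mul_assoc]
    simp_rw [h]
    exact integral_const_mul _ _

-- adapted from Theorems/MomentParityQuarticGateDefectCertificate.lean (line `recession-cone`)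
/-- **The pointwise row functionals.** For smooth fields `bᵢ`, an integrable force `f'`, a
viscosity `ν'` and every `v ∈ H`, `P ↦ ⟨F'(v), ∇p(v)⟩` is a linear functional on the homogeneous
cubic polynomials in the coordinates; with `ν' = 0`, `f' = 0` these are the Euler derivatives
`P ↦ {p, B}(v)`. [folklore] -/
theorem exists_pointRowFunctional (hb : ∀ i, Torus.IsSmooth (b i)) (ν' : ℝ)
    {f' : UnitAddTorus (Fin 3) → EuclideanSpace ℝ (Fin 3)} (hf' : Integrable f' volume) :
    ∃ ev : Torus.energySpace (Fin 3) → ↥(homogeneousSubmodule (Fin n) ℝ 3) →ₗ[ℝ] ℝ,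
      ∀ (v : Torus.energySpace (Fin 3)) (P : ↥(homogeneousSubmodule (Fin n) ℝ 3)),
        ev v P = Torus.nsGeneratorPairing ν' f' v (polyGrad b P.1 v) := by
  refine ⟨fun v =>
    { toFun := fun P => Torus.nsGeneratorPairing ν' f' v (polyGrad b P.1 v)
      map_add' := fun P Q => ?_
      map_smul' := fun c P => ?_ }, fun v P => rfl⟩
  · simp only [Submodule.coe_add, nsGeneratorPairing_polyGrad_eq_sum hb ν' hf', map_add, add_mul,
      Finset.sum_add_distrib]
  · simp only [Submodule.coe_smul, nsGeneratorPairing_polyGrad_eq_sum hb ν' hf', Derivation.map_smul,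
      smul_eval, Finset.mul_sum, mul_assoc, RingHom.id_apply, smul_eq_mul]

/-! ## The finite shear group -/

/-- **The shear group `H_L = {a : T³ | a 1 = 0, L • a = 0}` is finite** (`L > 0`; the `L`-torsion of
the circle is finite, `AddCircle.finite_torsion`). [folklore] -/
theorem finite_shearGroup (L : ℕ) (hL : 0 < L) :
    {a : UnitAddTorus (Fin 3) | a 1 = 0 ∧ L • a = 0}.Finite := by
  refine (Set.Finite.pi' (t := fun _ : Fin 3 => {x : UnitAddCircle | L • x = 0})
    fun _ => AddCircle.finite_torsion (1 : ℝ) hL).subset ?_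
  rintro a ⟨-, ha⟩ i
  have h := congr_fun ha i
  simpa using h

end AxialCert

/-- **Registered sub-goal `axialCert_cubicRowFunctional` of stub S3′** (summary of this file): under
a finite law on `H` with `∫ ‖u‖⁴ < ∞`, cubic rows over an orthonormal band basis are integrable and
the row is a linear functional on the homogeneous cubics. [folklore] -/
theorem axialCert_cubicRowFunctional : ∀ {N n : ℕ} {b : Fin n → UnitAddTorus (Fin 3) → EuclideanSpace ℝ (Fin 3)},
    (∀ i, IsBandTest N (b i)) → (∀ i j, ∫ x, ⟪b i x, b j x⟫_ℝ = if i = j then (1 : ℝ) else 0) →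
    ∀ (ν : ℝ) (f : UnitAddTorus (Fin 3) → EuclideanSpace ℝ (Fin 3)), Integrable f volume →
    ∀ (μ : Measure (Torus.energySpace (Fin 3))) [IsFiniteMeasure μ],
    Integrable (fun u : Torus.energySpace (Fin 3) => ‖u‖ ^ 4) μ →
    (∀ P : MvPolynomial (Fin n) ℝ, P.IsHomogeneous 3 →
      Integrable (fun u : Torus.energySpace (Fin 3) =>
        Torus.nsGeneratorPairing ν f u (polyGrad b P u)) μ) ∧
    ∃ ψ : ↥(MvPolynomial.homogeneousSubmodule (Fin n) ℝ 3) →ₗ[ℝ] ℝ,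
      ∀ P : ↥(MvPolynomial.homogeneousSubmodule (Fin n) ℝ 3),
        ψ P = ∫ u, Torus.nsGeneratorPairing ν f u (polyGrad b P.1 u) ∂μ :=
  fun hb hbo ν _ hf μ _ h4 => AxialCert.integrable_and_exists_cubicRowFunctional hb hbo ν hf μ h4

end Summit.AnomalousDissipation.AnomalousDissipation.Theorems.MomentParityQuarticGate
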